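import Mathlib
import HarnessLib.Audit
import Summits.PneNP.PneNP.Theorems.ClusHilbertPhi

/-!
# Route ClusUniversalCertificate — separator degrees and the peel identity `Φ(Y) = Φ(Y ∖ t) + δ_Y(t)` (hilbert-TII.md Lemmas 1–2)
(rung F-N1, cell pnp-ideate, crux `UniversalCertAll` = stmt-PneNP-19683; planner p1 g13, `HOME/pnp-ideate-p1/lines/hilbert-TII.md` §1 Lemma 1
(peel) and Lemma 2 (flats force degree), the typed statements `sepDeg`, `Phi_erase`, `le_sepDeg_of_flat` of `lines/hilbert-TII-UNREGISTERED.lean`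
VERBATIM (point type `ClusCube.V N`); ROUND-13's residual crux (LB-Φ)/(P2-Φ) is phrased through these separator degrees ("min Hilbert defect
≤ UC slack"); restricted-model combinatorics — nothing here bears on `P` versus `NP`)

* `sepDeg Y t` — the SEPARATOR DEGREE of `t` in `Y` (Geramita–Kreuzer–Robbiano's degree of a point): the least total degree of a polynomial that is
  `1` at `t` and `0` on `Y ∖ t`.  `sepDeg_le` : it is at most `N` (the point indicator, `ClusCube.flatInd_lowDegree` with `W = ⊥`).
* `le_sepDeg_of_flat` (**Lemma 2**): a `θ`-flat through `t` inside `Y` forces `δ_Y(t) ≥ θ` — a separator of degree `< θ` would sum to `0` over the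
  flat (`ClusHilbertPhi.sum_flat_eq_zero`) while it sums to `1`.
* `HF_eq_HF_erase_add` : `HF_Y(d) = HF_{Y∖t}(d) + [δ_Y(t) ≤ d]` — restriction to `Y ∖ t` is onto with kernel spanned by the indicator of `t`, which
  lies in the degree-`≤ d` space iff a separator of degree `≤ d` exists (rank–nullity).
* `Phi_erase` (**Lemma 1, peel**): `Φ(Y) = Φ(Y ∖ t) + δ_Y(t)` for `t ∈ Y`.
-/

set_option linter.dupNamespace false -- `Summit.PneNP.PneNP.…`: summit = sub-problem name (D-0017 single-conjunct layout)

namespace Summit.PneNP.PneNP.Theorems.ClusHilbert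

open Finset MvPolynomial
open Summit.PneNP.PneNP.Theorems.ClusCube (V flatInd flatInd_lowDegree)

variable {N : ℕ}

/-! ## Separator degree -/

/-- separator degree `δ_Y(t)` (Geramita–Kreuzer–Robbiano's "degree of a point") -/
noncomputable def sepDeg (Y : Finset (V N)) (t : V N) : ℕ :=
  sInf {d : ℕ | ∃ p : MvPolynomial (Fin N) (ZMod 2), p.totalDegree ≤ d ∧
    MvPolynomial.eval t p = 1 ∧ ∀ y ∈ Y, y ≠ t → MvPolynomial.eval y p = 0}

/-- A separator of degree `≤ N` always exists (the indicator of the point `t`). -/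
theorem exists_separator (Y : Finset (V N)) (t : V N) :
    ∃ p : MvPolynomial (Fin N) (ZMod 2), p.totalDegree ≤ N ∧ MvPolynomial.eval t p = 1 ∧ ∀ y ∈ Y, y ≠ t → MvPolynomial.eval y p = 0 := by
  obtain ⟨P, hdeg, hP⟩ := flatInd_lowDegree t (⊥ : Submodule (ZMod 2) (V N))
  refine ⟨P, by rw [finrank_bot] at hdeg; omega, ?_, fun y _ hy => ?_⟩
  · rw [hP]; unfold flatInd; rw [sub_self, if_pos (Submodule.zero_mem _)]
  · rw [hP]; unfold flatInd; rw [if_neg]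
    rw [Submodule.mem_bot, sub_eq_zero]; exact hy

/-- The separator degree is attained. -/
theorem exists_separator_sepDeg (Y : Finset (V N)) (t : V N) :
    ∃ p : MvPolynomial (Fin N) (ZMod 2), p.totalDegree ≤ sepDeg Y t ∧ MvPolynomial.eval t p = 1 ∧
      ∀ y ∈ Y, y ≠ t → MvPolynomial.eval y p = 0 := by
  obtain ⟨p, hp⟩ := exists_separator Y t
  exact Nat.sInf_mem (s := {d : ℕ | ∃ p : MvPolynomial (Fin N) (ZMod 2), p.totalDegree ≤ d ∧
    MvPolynomial.eval t p = 1 ∧ ∀ y ∈ Y, y ≠ t → MvPolynomial.eval y p = 0}) ⟨N, p, hp⟩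

/-- A separator of degree `≤ d` bounds the separator degree. -/
theorem sepDeg_le_of_separator (Y : Finset (V N)) (t : V N) {d : ℕ} {p : MvPolynomial (Fin N) (ZMod 2)} (hdeg : p.totalDegree ≤ d)
    (h1 : MvPolynomial.eval t p = 1) (h0 : ∀ y ∈ Y, y ≠ t → MvPolynomial.eval y p = 0) : sepDeg Y t ≤ d :=
  Nat.sInf_le ⟨p, hdeg, h1, h0⟩

/-- `δ_Y(t) ≤ N`. -/
theorem sepDeg_le (Y : Finset (V N)) (t : V N) : sepDeg Y t ≤ N := by
  obtain ⟨p, hdeg, h1, h0⟩ := exists_separator Y t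
  exact sepDeg_le_of_separator Y t hdeg h1 h0

/-! ## Lemma 2: flats force degree -/

open scoped Classical in
/-- **Lemma 2.**  An affine subspace `t + U` inside `Y` forces `δ_Y(t) ≥ dim U`: a separator of smaller degree would sum to zero over the flat
(`sum_flat_eq_zero`), but it sums to `1`. -/
theorem le_sepDeg_of_flat (Y : Finset (V N)) (t : V N) (U : Submodule (ZMod 2) (V N))
    (hU : ∀ u ∈ U, t + u ∈ Y) : Module.finrank (ZMod 2) U ≤ sepDeg Y t := by
  by_contra hlt
  rw [not_le] at hlt
  obtain ⟨p, hdeg, h1, h0⟩ := exists_separator_sepDeg Y t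
  have hsum := sum_flat_eq_zero U hlt t (eval_mem_Pdeg p hdeg)
  rw [sum_eq_single_of_mem t (mem_filter.2 ⟨mem_univ _, by rw [sub_self]; exact U.zero_mem⟩)] at hsum
  · exact one_ne_zero (h1 ▸ hsum)
  · intro v hv hvt
    have hvU := (mem_filter.1 hv).2
    have hvY : v ∈ Y := by
      have := hU _ hvU
      rwa [add_sub_cancel] at this
    exact h0 v hvY hvt

/-! ## Lemma 1: the peel identity -/

/-- **Rank drop under deleting a point**: `HF_Y(d) = HF_{Y∖t}(d) + [δ_Y(t) ≤ d]` for `t ∈ Y`. -/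
theorem HF_eq_HF_erase_add (Y : Finset (V N)) {t : V N} (ht : t ∈ Y) (d : ℕ) :
    HF Y d = HF (Y.erase t) d + (if sepDeg Y t ≤ d then 1 else 0) := by
  classical
  set R := MvPolynomial.restrictTotalDegree (Fin N) (ZMod 2) d with hR
  set W := Submodule.map (evalOn Y) R with hW
  -- restriction from `Y` to `Y ∖ t`
  let res : (Y → ZMod 2) →ₗ[ZMod 2] (↥(Y.erase t) → ZMod 2) :=
    { toFun := fun f v => f ⟨v.1, mem_of_mem_erase v.2⟩
      map_add' := fun _ _ => rfl
      map_smul' := fun _ _ => rfl }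
  have hcomp : W.map res = Submodule.map (evalOn (Y.erase t)) R := by
    rw [hW, ← Submodule.map_comp]
    congr 1
  -- rank–nullity for `res` on `W`
  have hrn := LinearMap.finrank_range_add_finrank_ker (res.domRestrict W)
  rw [LinearMap.range_domRestrict, hcomp] at hrn
  -- the kernel: functions of `W` supported at `t`
  let δ : Y → ZMod 2 := fun v => if (v : V N) = t then 1 else 0
  have hker_mem : ∀ w : W, w ∈ LinearMap.ker (res.domRestrict W) ↔ ∀ v : Y, (v : V N) ≠ t → (w : Y → ZMod 2) v = 0 := by
    intro w
    rw [LinearMap.mem_ker, LinearMap.domRestrict_apply]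
    constructor
    · intro h v hv
      exact congrFun h ⟨v.1, mem_erase.2 ⟨hv, v.2⟩⟩
    · intro h
      funext v
      exact h ⟨v.1, mem_of_mem_erase v.2⟩ (ne_of_mem_erase v.2)
  have hsep : (∃ p ∈ R, evalOn Y p = δ) ↔ sepDeg Y t ≤ d := by
    constructor
    · rintro ⟨p, hp, hpδ⟩
      rw [hR, MvPolynomial.mem_restrictTotalDegree] at hp
      refine sepDeg_le_of_separator Y t hp ?_ (fun y hy hyt => ?_)
      · have := congrFun hpδ ⟨t, ht⟩
        simpa [evalOn, δ] using this
      · have := congrFun hpδ ⟨y, hy⟩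
        simpa [evalOn, δ, hyt] using this
    · intro hle
      obtain ⟨p, hdeg, h1, h0⟩ := exists_separator_sepDeg Y t
      refine ⟨p, by rw [hR, MvPolynomial.mem_restrictTotalDegree]; exact hdeg.trans hle, ?_⟩
      funext v
      by_cases hv : (v : V N) = t
      · simp only [δ, if_pos hv]; show MvPolynomial.eval (v : V N) p = 1; rw [hv, h1]
      · simp only [δ, if_neg hv]; exact h0 v v.2 hv
  have hker : Module.finrank (ZMod 2) (LinearMap.ker (res.domRestrict W)) = if sepDeg Y t ≤ d then 1 else 0 := by
    by_cases hle : sepDeg Y t ≤ d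
    · rw [if_pos hle]
      obtain ⟨p, hp, hpδ⟩ := hsep.2 hle
      have hδW : δ ∈ W := Submodule.mem_map.2 ⟨p, hp, hpδ⟩
      -- the kernel is the line through `δ`
      have hline : LinearMap.ker (res.domRestrict W) = (ZMod 2) ∙ (⟨δ, hδW⟩ : W) := by
        refine le_antisymm (fun w hw => ?_) ?_
        · rw [Submodule.mem_span_singleton]
          refine ⟨(w : Y → ZMod 2) ⟨t, ht⟩, Subtype.ext ?_⟩
          funext v
          show ((w : Y → ZMod 2) ⟨t, ht⟩) • δ v = (w : Y → ZMod 2) v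
          by_cases hv : (v : V N) = t
          · have : v = ⟨t, ht⟩ := Subtype.ext hv
            subst this
            simp [δ]
          · simp only [δ, if_neg hv, smul_eq_mul, mul_zero]
            exact ((hker_mem w).1 hw v hv).symm
        · rw [Submodule.span_le, Set.singleton_subset_iff, SetLike.mem_coe, hker_mem]
          intro v hv
          show δ v = 0
          simp only [δ, if_neg hv]
      rw [hline, finrank_span_singleton]
      intro h0
      have := congrFun (congrArg Subtype.val h0) ⟨t, ht⟩
      simp [δ] at this
    · rw [if_neg hle]
      refine (Submodule.finrank_eq_zero (R := ZMod 2)).2 ((Submodule.eq_bot_iff _).2 fun w hw => ?_)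
      have hzero : ∀ v : Y, (w : Y → ZMod 2) v = 0 := by
        intro v
        by_cases hv : (v : V N) = t
        · by_contra hne
          have h1 : (w : Y → ZMod 2) v = 1 := by
            rcases (by decide : ∀ z : ZMod 2, z = 0 ∨ z = 1) ((w : Y → ZMod 2) v) with h | h
            · exact absurd h hne
            · exact h
          apply hle
          apply hsep.1
          obtain ⟨p, hp, hpw⟩ := Submodule.mem_map.1 w.2
          refine ⟨p, hp, ?_⟩
          rw [hpw]
          funext v'
          by_cases hv' : (v' : V N) = t
          · have : v' = v := Subtype.ext (hv'.trans hv.symm)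
            rw [this, h1]
            simp only [δ]
            rw [if_pos hv]
          · simp only [δ, if_neg hv']
            exact (hker_mem w).1 hw v' hv'
        · exact (hker_mem w).1 hw v hv
      exact Subtype.ext (funext hzero)
  unfold HF
  rw [← hW, ← hrn, hker]

/-- The Hilbert function of a point set is at most its size. -/
theorem HF_le_card (Y : Finset (V N)) (d : ℕ) : HF Y d ≤ Y.card := by
  unfold HF
  exact (Submodule.finrank_le _).trans (by rw [Module.finrank_pi, Fintype.card_coe])

/-- **Lemma 1 (peel): `Φ(Y) = Φ(Y ∖ t) + δ_Y(t)` for `t ∈ Y`.** -/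
theorem Phi_erase (Y : Finset (V N)) (t : V N) (ht : t ∈ Y) :
    Phi Y = Phi (Y.erase t) + sepDeg Y t := by
  unfold Phi
  have hterm : ∀ d, Y.card - HF Y d = ((Y.erase t).card - HF (Y.erase t) d) + (if d < sepDeg Y t then 1 else 0) := by
    intro d
    rw [HF_eq_HF_erase_add Y ht d, card_erase_of_mem ht]
    have h1 := HF_le_card (Y.erase t) d
    rw [card_erase_of_mem ht] at h1
    have h2 := card_pos.2 ⟨t, ht⟩
    split_ifs with h3 h4 <;> omega
  rw [sum_congr rfl fun d _ => hterm d, sum_add_distrib]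
  congr 1
  rw [sum_boole, Nat.cast_id]
  have : (range N).filter (fun d => d < sepDeg Y t) = range (sepDeg Y t) := by
    ext d
    simp only [mem_filter, mem_range]
    have := sepDeg_le Y t
    omega
  rw [this, card_range]

end Summit.PneNP.PneNP.Theorems.ClusHilbert
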